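/-
Copyright (c) 2026 the pub-hodgecm-mathlib formalisation cell (harness21).  Prover seat hodgecm-mathlib-K2E4-p10 (g8), Track B «K2-LIT»,
#184♮ = hLiu418 = `stmt-HodgeConjecture-24832`; ROAD Φ of socket #41, TABLE #7 (h3) «KIND-W factor∕growth heads», desk K2E5-p17 (g8) split 16:17:21Z: K2E4-p10 = the weighted
growth `(w hw0 hws hg)`; THIS FILE = piece (W3a) of the 16:17:17Z census — the pure-analysis brick «EXPONENTIAL DECAY ⇒ ANY POLYNOMIAL WEIGHT, WITH AN EXPLICIT CONSTANT».
THEOREMS ONLY (no `def`, no instance, no notation, no named-fact hypothesis, no `sorry`); Mathlib-level.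
-/
import Mathlib.Analysis.Complex.Exponential
import Mathlib.Analysis.SpecialFunctions.Pow.Real
import HarnessLib

/-!
# Crux `HLiu418`, ROAD Φ of socket #41, (h3)∕(W3a) — `K2LiuExpDecayPolynomialWeight`: `e^{−aτ}·(1+τ)^N ≤ (e^{a}·(N+k)!·a^{−(N+k)})·(1+τ)^{−k}` (`a > 0`, `τ ≥ 0`, `N k : ℕ`)

Cell `hodgecm-mathlib`, crux item hLiu418 = `stmt-HodgeConjecture-24832` (helper lane `--supports … --as helper`, count-neutral); squad K2 ∕ K2Liu, road `K2_Liu`, socket #41.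
THE MATHEMATICS ([Shimura1997, §18.4 (Gaussian decay of archimedean Whittaker functions)]; [MoeglinWaldspurger1995, IV.1.9]; folklore calculus).  The KIND-W weighted growth of the TOP
(`‖WT S·GW S‖ ≤ C(z)·w(S)·‖h‖^A` with `Σ_S w(S) < ∞`, ★ p861376∕p861446∕p861512) is produced from the archimedean GAUSSIAN decay `e^{−c·tr(S·yy*)}·(1 + tr S)^N` of the Whittaker function
(row G4 ★ Φ6b-5) by trading the exponential for an arbitrary polynomial weight `(1 + tr S)^{−k}` — the constant then carries `λ_min(yy*)^{−(N+k)}`, which row G7 (★ `K2LiuIwasawaHeightLatticeSumBound`)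
bounds by a power of the height `‖h‖`.  The trade is elementary: `x^m∕m! ≤ e^x` (Mathlib `Real.pow_div_factorial_le_exp`) gives `e^{−x} ≤ m!·x^{−m}` for `x > 0`, whence, with `u = 1 + τ ≥ 1`
and `e^{−aτ} = e^{a}·e^{−au}`, **`e^{−aτ}·(1+τ)^N ≤ (e^{a}(N+k)!∕a^{N+k})·(1+τ)^{−k}`**, monotone in `a` (for `a ≥ a₀ > 0` the constant of `a₀` serves).
* §1 `exp_neg_mul_pow_le` (`e^{−au}·u^m ≤ m!∕a^m`, `u ≥ 0`; the scalar step `e^{−x} ≤ m!∕x^m` is Mathlib `Real.pow_div_factorial_le_exp`, standalone ★ in `Literature.Computability.Complexity.GoldwasserSipser`).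
* §2 **`exp_neg_mul_one_add_pow_le`** (the displayed trade), **`exp_neg_mul_one_add_pow_le_of_le`** (uniform on `a₀ ≤ a`), and the `rpow` reading **`exp_neg_mul_one_add_pow_le_rpow_neg`**
  (`… ≤ C·(1+τ)^(−(k:ℝ))`, the shape of ★ `summable_one_add_norm_rpow_neg`'s weights).
NOT HERE: the lattice summation (row G7's currency) and the instantiation at `τ = tr(S)`, `a = c·λ_min(yy*)` — piece (W3b), against F0P2-p08 (g0)'s `WT∕GW` heads.
HONEST LABEL.  Count-neutral helper; `HC_CM` is proved only modulo the 7 printed citations (2 remaining named inputs: hLiu418 = `stmt-HodgeConjecture-24832`,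
h413 = `stmt-HodgeConjecture-24833`) until rung 0 closes.
-/

set_option autoImplicit false
set_option linter.dupNamespace false -- the mandated namespace repeats `HodgeConjecture.HodgeConjecture`

noncomputable section

namespace Summit.HodgeConjecture.HodgeConjecture.Cruxes.HLiu418.K2LiuExpDecayPolynomialWeight

open Real Nat

/-! ## §1 `e^{−au}·u^m ≤ m!·a^{−m}` -/

/-- **`e^{−a·u}·u^m ≤ m! ∕ a^m`** for `a > 0`, `u ≥ 0`. [folklore] -/
theorem exp_neg_mul_pow_le {a : ℝ} (ha : 0 < a) {u : ℝ} (hu : 0 ≤ u) (m : ℕ) : Real.exp (-(a * u)) * u ^ m ≤ (m ! : ℝ) / a ^ m := by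
  rcases hu.eq_or_lt with rfl | hu'
  · -- `u = 0`
    cases m with
    | zero => simp
    | succ m => simp only [mul_zero, neg_zero, Real.exp_zero, ne_eq, Nat.succ_ne_zero, not_false_eq_true, zero_pow]; positivity
  · have hau : 0 < a * u := mul_pos ha hu'
    -- `e^{−x} ≤ m!∕x^m` for `x = a·u > 0` (Mathlib `Real.pow_div_factorial_le_exp`; the standalone statement is ★ `Literature.Computability.Complexity.GoldwasserSipser.exp_neg_le_factorial_div_pow`)
    have h : Real.exp (-(a * u)) ≤ (m ! : ℝ) / (a * u) ^ m := by
      have h0 := Real.pow_div_factorial_le_exp (x := a * u) hau.le m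
      have hm : (0 : ℝ) < m ! := by exact_mod_cast Nat.factorial_pos m
      rw [Real.exp_neg, inv_eq_one_div, div_le_div_iff₀ (Real.exp_pos _) (pow_pos hau m), one_mul]
      rw [div_le_iff₀ hm] at h0
      linarith
    have hum : 0 < u ^ m := pow_pos hu' m
    calc Real.exp (-(a * u)) * u ^ m ≤ (m ! : ℝ) / (a * u) ^ m * u ^ m := mul_le_mul_of_nonneg_right h hum.le
      _ = (m ! : ℝ) / a ^ m := by rw [mul_pow]; field_simp

/-! ## §2 The trade: exponential decay for a polynomial weight -/

/-- **THE TRADE `e^{−aτ}·(1+τ)^N ≤ (e^{a}·(N+k)!∕a^{N+k})·((1+τ)^k)⁻¹`** (`a > 0`, `τ ≥ 0`, `N k : ℕ`): with `u = 1+τ`, `e^{−aτ} = e^{a}e^{−au}` and §1 at exponent `N+k`.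
[cite: Shimura1997, §18.4] [cite: MoeglinWaldspurger1995, IV.1.9] -/
theorem exp_neg_mul_one_add_pow_le {a : ℝ} (ha : 0 < a) {τ : ℝ} (hτ : 0 ≤ τ) (N k : ℕ) :
    Real.exp (-(a * τ)) * (1 + τ) ^ N ≤ (Real.exp a * (N + k) ! / a ^ (N + k)) * ((1 + τ) ^ k)⁻¹ := by
  have hu : (0 : ℝ) < 1 + τ := by linarith
  have huk : 0 < (1 + τ) ^ k := pow_pos hu k
  have h1 := exp_neg_mul_pow_le ha hu.le (N + k)
  -- `e^{−aτ} = e^{a}·e^{−a(1+τ)}`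
  have he : Real.exp (-(a * τ)) = Real.exp a * Real.exp (-(a * (1 + τ))) := by
    rw [← Real.exp_add]; congr 1; ring
  rw [he, le_mul_inv_iff₀ huk]
  calc Real.exp a * Real.exp (-(a * (1 + τ))) * (1 + τ) ^ N * (1 + τ) ^ k
      = Real.exp a * (Real.exp (-(a * (1 + τ))) * (1 + τ) ^ (N + k)) := by rw [pow_add]; ring
    _ ≤ Real.exp a * ((N + k) ! / a ^ (N + k)) := mul_le_mul_of_nonneg_left h1 (Real.exp_pos a).le
    _ = Real.exp a * (N + k) ! / a ^ (N + k) := by ring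

/-- **UNIFORMITY IN `a ≥ a₀ > 0`**: the constant of `a₀` serves for every `a ≥ a₀` (`e^{−aτ} ≤ e^{−a₀τ}`). [folklore] -/
theorem exp_neg_mul_one_add_pow_le_of_le {a₀ a : ℝ} (ha₀ : 0 < a₀) (ha : a₀ ≤ a) {τ : ℝ} (hτ : 0 ≤ τ) (N k : ℕ) :
    Real.exp (-(a * τ)) * (1 + τ) ^ N ≤ (Real.exp a₀ * (N + k) ! / a₀ ^ (N + k)) * ((1 + τ) ^ k)⁻¹ := by
  refine le_trans ?_ (exp_neg_mul_one_add_pow_le ha₀ hτ N k)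
  have hN : (0 : ℝ) ≤ (1 + τ) ^ N := pow_nonneg (by linarith) N
  exact mul_le_mul_of_nonneg_right (Real.exp_le_exp.2 (by nlinarith)) hN

/-- **`rpow` READING** (the weight shape of ★ `summable_one_add_norm_rpow_neg`): `e^{−aτ}·(1+τ)^N ≤ (e^{a}(N+k)!∕a^{N+k})·(1+τ)^{−(k:ℝ)}`. [folklore] -/
theorem exp_neg_mul_one_add_pow_le_rpow_neg {a : ℝ} (ha : 0 < a) {τ : ℝ} (hτ : 0 ≤ τ) (N k : ℕ) :
    Real.exp (-(a * τ)) * (1 + τ) ^ N ≤ (Real.exp a * (N + k) ! / a ^ (N + k)) * (1 + τ) ^ (-(k : ℝ)) := by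
  have hu : (0 : ℝ) < 1 + τ := by linarith
  have h := exp_neg_mul_one_add_pow_le ha hτ N k
  rwa [Real.rpow_neg hu.le, Real.rpow_natCast] at *

/-- the constant is POSITIVE (bookkeeping for the clause-(v) growth letters). [folklore] -/
theorem tradeConst_pos {a : ℝ} (ha : 0 < a) (N k : ℕ) : 0 < Real.exp a * (N + k) ! / a ^ (N + k) := by
  have : (0 : ℝ) < (N + k) ! := by exact_mod_cast Nat.factorial_pos (N + k)
  positivity

end Summit.HodgeConjecture.HodgeConjecture.Cruxes.HLiu418.K2LiuExpDecayPolynomialWeight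

end
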